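/-
Copyright: cell `pub-ymgap` (HUMAN RULING D-0062), Track A of `YM-PLAN.md`, DAG node N20 (= NE7b); R134 acceleration seat
`pub-ymgap-dag-n20-c` (strategy s1, generation 2), module 6.  Released under the licence of the surrounding project.
-/
import Summits.QuantumFields.BalabanUV.T4Continuum.Spine.NE7b.LocalPlaquetteExpMomentsEven
import Summits.QuantumFields.BalabanUV.T4Continuum.Spine.NE7b.LocalPlaquetteExpMomentsAll
import HarnessLib

/-!
# YM-DAG node N20 (= NE7b), strategy s1, module 6: (LS) RUNG 0 ON EVEN FOUR-TORI IN EVERY ORIENTATION CLASS — local exponential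
# plaquette moments for arbitrary plaquette sets and the mean plaquette energy, uniformly in `β ≥ 4` and the volume

Track A of `YM-PLAN.md` (cell `pub-ymgap`, HUMAN RULING D-0062), node **N20** = spine estimate NE7b (`T4WeightBudget.RelWeightBound` — the
cell `pub-balaban`'s OWN estimate, NOT PRINTED in [Bałaban 1983–89], NOT PROVED).  Seat `pub-ymgap-dag-n20-c` (R134, s1 «the
`LocCondStability` INSTANCE for Bałaban's tower at a pinned 𝐑𝐓 step»), module 6 (modules 1–5: `…Theorems.BalabanUVNodesN20LCSPushforward`
p453912, `…LoopEnergies` p455890, `…AtTStepOfRecord` p456203, `…LoopEnergiesEven` p456841, `…CoarseSparseness` p457686).  Kernel theorems only: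
0 `def`, 0 `sorry`, standard axioms; COUNT-NEUTRAL; `--supports` the K3 item `SpineGivenEndpointR11` (stmt-QuantumFields-19676).

WHY (g0's located residual (iii), `N20-S1-TRIAGE.md` §1 «carrier junction»: NODE 00's tori `F.P K` have EVEN side `2·L^{m+K}`, and the
tree's even-torus rung 0 `LocalPlaquetteExpMomentsEven.localExpMoment_class01_even` is the `01`-class ONLY — «the other five classes … by the
axis symmetry of Wilson's measure … not repeated here»).  THIS FILE types the other five classes and the consequences module 7
(`…Theorems.BalabanUVNodesN20LCSAtRecordLevelZero`) reads AT THE RECORD: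
* §1 **`integral_exp_classSum_eq_of_perm`** — a coordinate permutation `π` with `π⁻¹ 0 = i`, `π⁻¹ 1 = j` carries the exponential moment of
  the class-`(i,j)` energies over the sites `Q` to that of the class-`01` energies over `sitePerm π '' Q` (invariance of Wilson's state
  `wilsonMeasure_map_configPerm`, `plaquetteHolonomy_configPerm`); **`localExpMoment_class_even`** — for a faithful continuous unitary lattice
  representation `r` of a compact `G` ONE `C = C(r) ≥ 0` with `∫ exp(a·β·Σ_{x∈Q}(N − Re tr r(U_{(x,o)}))) dμ_β ≤ exp(C·a·#Q)` for EVERY even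
  torus `(ℤ∕L)⁴`, every `β ≥ 4`, `0 ≤ a ≤ ½`, every orientation class `o` and every finite set of sites `Q`.
* §2 **`localExpMoment_even`** — arbitrary finite plaquette sets `X`, `0 ≤ a ≤ 1∕12`: `∫ exp(a·β·Σ_{p∈X}(N − Re tr r(U_p))) dμ_β ≤ exp(C·a·#X)`
  (Jensen over the six classes; the even twin of `LocalPlaquetteExpMomentsAll.localExpMoment`); **`integral_plaqEnergy_le_div_even`** — the mean
  plaquette energy is `≤ C'∕β` on every even four-torus, `β ≥ 4`.

HONEST FRAMING.  Rung 0 of (LS) (the BARE Wilson measure) in the host tree's `GaugeConfig 4 L G` currency; the record-level reading is module 7.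
Residuals (i) (domination letter for Bałaban's smeared `avOfRecord`), (ii) (the restricted-measure ∕ conditional chessboard — the tree's even
chessboards `chessboard_le_rpow_even` ∕ `WilsonPlaquetteChessboardEvenSide` are ONE-function estimates; the two-function form a small-field
restriction needs is not in the tree) and (iv) (levels `≥ 2`, (A1c)) of module 1 UNCHANGED.  NE7b NOT PRINTED ∕ NOT PROVED; (α)-instance 0∕1;
N20 NOT discharged; typed 28∕28, discharged count untouched; one finite four-torus at fixed `ε` — NOT ℝ⁴, NOT infinite volume, NOT OS, NOT a
mass gap, NOT Clay.
-/

set_option autoImplicit false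

noncomputable section

namespace Summit.QuantumFields.YangMills.BalabanUVNodes.N20LCSEvenAllClasses

open MeasureTheory
open Literature.MathematicalPhysics.QuantumFieldTheory
open Summit.QuantumFields.BalabanUV.T4Continuum.NE7b.LocalPlaquetteExpMoments

/-! ## §1 Even four-tori, every orientation class (axis symmetry of Wilson's state) -/

section EvenClass

variable {G : Type} [Group G] [TopologicalSpace G] [IsTopologicalGroup G] [CompactSpace G]
  [MeasurableSpace G] [BorelSpace G]

/-- **TRANSPORT OF A CLASS MOMENT UNDER A COORDINATE PERMUTATION.**  If `π⁻¹ 0 = i` and `π⁻¹ 1 = j` (`i < j`), the exponential moment of the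
class-`(i,j)` plaquette energies over the sites `Q` equals the exponential moment of the class-`01` energies over the sites `sitePerm π '' Q`
(invariance of Wilson's state under `configPerm π`, `wilsonMeasure_map_configPerm`; a plaquette goes to a plaquette, `plaquetteHolonomy_configPerm`).
[folklore] -/
theorem integral_exp_classSum_eq_of_perm {N L : ℕ} [NeZero L] (ρ : G →* Matrix (Fin N) (Fin N) ℂ) (hρ : Continuous ρ)
    (β t : ℝ) (π : Equiv.Perm (Fin 4)) {i j : Fin 4} (hij : i < j) (hi : π.symm 0 = i) (hj : π.symm 1 = j)
    (Q : Finset (Site 4 L)) :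
    ∫ U, Real.exp (t * ∑ x ∈ Q, ((N : ℝ) - WilsonRP.plaqRe ρ U (x, ⟨(i, j), hij⟩)))
        ∂(wilsonMeasure ρ β : Measure (GaugeConfig 4 L G)) =
      ∫ U, Real.exp (t * ∑ y ∈ Q.map (sitePerm π).toEmbedding,
          ((N : ℝ) - (ρ (plaquetteHolonomy U y 0 1)).trace.re)) ∂(wilsonMeasure ρ β : Measure (GaugeConfig 4 L G)) := by
  set f : GaugeConfig 4 L G → ℝ := fun V => Real.exp (t * ∑ y ∈ Q.map (sitePerm π).toEmbedding,
    ((N : ℝ) - (ρ (plaquetteHolonomy V y 0 1)).trace.re)) with hf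
  have hcomp : ∀ U : GaugeConfig 4 L G,
      f (configPerm π U) = Real.exp (t * ∑ x ∈ Q, ((N : ℝ) - WilsonRP.plaqRe ρ U (x, ⟨(i, j), hij⟩))) := by
    intro U
    have hss : ∀ x : Site 4 L, sitePerm π.symm (sitePerm π x) = x := fun x => by
      funext k
      simp only [sitePerm_apply, Equiv.symm_symm, Equiv.symm_apply_apply]
    simp only [hf, Finset.sum_map, Equiv.coe_toEmbedding, plaquetteHolonomy_configPerm, hi, hj, hss]
    rfl
  calc ∫ U, Real.exp (t * ∑ x ∈ Q, ((N : ℝ) - WilsonRP.plaqRe ρ U (x, ⟨(i, j), hij⟩)))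
        ∂(wilsonMeasure ρ β : Measure (GaugeConfig 4 L G))
      = ∫ U, f (configPerm π U) ∂(wilsonMeasure ρ β : Measure (GaugeConfig 4 L G)) :=
        integral_congr_ae (ae_of_all _ fun U => (hcomp U).symm)
    _ = ∫ V, f V ∂((wilsonMeasure ρ β : Measure (GaugeConfig 4 L G)).map (configPerm π)) :=
        (integral_map_equiv _ _).symm
    _ = ∫ V, f V ∂(wilsonMeasure ρ β : Measure (GaugeConfig 4 L G)) := by
        rw [wilsonMeasure_map_configPerm ρ hρ β π]

/-- **LOCAL EXPONENTIAL PLAQUETTE MOMENTS ON EVEN FOUR-TORI, EVERY ORIENTATION CLASS** ((LS) rung 0; the tree's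
`localExpMoment_class01_even` is the class `01`, the other five classes by the axis symmetry of Wilson's state).  For a faithful continuous
unitary lattice representation `r` of a compact group `G` there is `C ≥ 0` such that for every even torus `(ℤ∕L)⁴`, every `β ≥ 4`, every
`0 ≤ a ≤ ½`, every orientation class `o` and every finite set of sites `Q`:
`∫ exp(a·β·Σ_{x∈Q} (N − Re tr r(U_{(x,o)}))) dμ_β ≤ exp(C·a·#Q)`. [folklore] -/
theorem localExpMoment_class_even (r : LatticeRep G) :
    ∃ C : ℝ, 0 ≤ C ∧ ∀ (L : ℕ) [NeZero L], Even L → ∀ (β : ℝ), 4 ≤ β → ∀ (a : ℝ), 0 ≤ a → a ≤ 1 / 2 →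
      ∀ (o : {q : Fin 4 × Fin 4 // q.1 < q.2}) (Q : Finset (Site 4 L)),
        ∫ U, Real.exp (a * β * ∑ x ∈ Q, ((r.N : ℝ) - WilsonRP.plaqRe r.ρ U (x, o)))
            ∂(wilsonMeasure r.ρ β : Measure (GaugeConfig 4 L G)) ≤
          Real.exp (C * a * Q.card) := by
  obtain ⟨C, hC0, hC⟩ := localExpMoment_class01_even r
  refine ⟨C, hC0, fun L _ hL β hβ a ha0 ha o Q => ?_⟩
  obtain ⟨⟨i, j⟩, hij⟩ := o
  -- a coordinate permutation with `π i = 0`, `π j = 1` (two transpositions)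
  obtain ⟨π, hi, hj⟩ : ∃ π : Equiv.Perm (Fin 4), π i = 0 ∧ π j = 1 := by
    refine ⟨(Equiv.swap i 0).trans (Equiv.swap (Equiv.swap i 0 j) 1), ?_, ?_⟩
    · rw [Equiv.trans_apply, Equiv.swap_apply_left]
      refine Equiv.swap_apply_of_ne_of_ne (fun h => (ne_of_lt hij) ?_) (by decide)
      have h' : Equiv.swap i 0 j = Equiv.swap i 0 i := by rw [Equiv.swap_apply_left]; exact h.symm
      exact ((Equiv.swap i 0).injective h').symm
    · rw [Equiv.trans_apply, Equiv.swap_apply_left]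
  have hi' : π.symm 0 = i := by rw [← hi, Equiv.symm_apply_apply]
  have hj' : π.symm 1 = j := by rw [← hj, Equiv.symm_apply_apply]
  rw [integral_exp_classSum_eq_of_perm r.ρ r.continuous β (a * β) π hij hi' hj' Q]
  have h := hC L hL β hβ a ha0 ha (Q.map (sitePerm π).toEmbedding)
  rwa [Finset.card_map] at h

end EvenClass

/-! ## §2 Even four-tori, arbitrary plaquette sets; the mean plaquette energy -/

section EvenAll

variable {G : Type} [Group G] [TopologicalSpace G] [IsTopologicalGroup G] [CompactSpace G]
  [MeasurableSpace G] [BorelSpace G]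

/-- **LOCAL EXPONENTIAL PLAQUETTE MOMENTS ON EVEN FOUR-TORI, ARBITRARY PLAQUETTE SETS.**  For a faithful continuous unitary lattice
representation `r` of a compact group `G` there is `C ≥ 0` such that for every even torus `(ℤ∕L)⁴`, every `β ≥ 4`, every `0 ≤ a ≤ 1∕12`
and every finite set `X` of plaquettes: `∫ exp(a·β·Σ_{p∈X} (N − Re tr r(U_p))) dμ_β ≤ exp(C·a·#X)` (Jensen over the six orientation classes,
then `localExpMoment_class_even` at `6a ≤ ½`; the even twin of `LocalPlaquetteExpMomentsAll.localExpMoment`). [folklore] -/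
theorem localExpMoment_even (r : LatticeRep G) :
    ∃ C : ℝ, 0 ≤ C ∧ ∀ (L : ℕ) [NeZero L], Even L → ∀ (β : ℝ), 4 ≤ β → ∀ (a : ℝ), 0 ≤ a → a ≤ 1 / 12 →
      ∀ (X : Finset (Plaquette 4 L)),
        ∫ U, Real.exp (a * β * ∑ p ∈ X, ((r.N : ℝ) - WilsonRP.plaqRe r.ρ U p))
            ∂(wilsonMeasure r.ρ β : Measure (GaugeConfig 4 L G)) ≤
          Real.exp (C * a * X.card) := by
  obtain ⟨C, hC0, hC⟩ := localExpMoment_class_even r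
  refine ⟨6 * C, by positivity, fun L _ hL β hβ a ha0 ha X => ?_⟩
  haveI hprob := isProbabilityMeasure_wilsonMeasure (d := 4) (L := L) (G := G) r.ρ r.continuous β
  have card_orient : Fintype.card {q : Fin 4 × Fin 4 // q.1 < q.2} = 6 := by decide
  set μ : Measure (GaugeConfig 4 L G) := wilsonMeasure r.ρ β with hμ
  have hβ0 : 0 ≤ β := by linarith
  set E : {q : Fin 4 × Fin 4 // q.1 < q.2} → GaugeConfig 4 L G → ℝ :=
    fun o U => ∑ x ∈ (Finset.univ.filter fun x => (x, o) ∈ X), ((r.N : ℝ) - WilsonRP.plaqRe r.ρ U (x, o)) with hE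
  -- Jensen for `exp` over the six classes, pointwise
  have hJ : ∀ U : GaugeConfig 4 L G,
      Real.exp (a * β * ∑ p ∈ X, ((r.N : ℝ) - WilsonRP.plaqRe r.ρ U p)) ≤
        ∑ o : {q : Fin 4 × Fin 4 // q.1 < q.2}, (1 / 6 : ℝ) * Real.exp (6 * a * β * E o U) := by
    intro U
    have hsplit : a * β * ∑ p ∈ X, ((r.N : ℝ) - WilsonRP.plaqRe r.ρ U p) =
        ∑ o : {q : Fin 4 × Fin 4 // q.1 < q.2}, (1 / 6 : ℝ) • (6 * a * β * E o U) := by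
      rw [sum_plaquette_eq_sum_class X, Finset.mul_sum]
      refine Finset.sum_congr rfl fun o _ => ?_
      simp only [hE, smul_eq_mul]
      ring
    have hj := (convexOn_exp.map_sum_le (t := (Finset.univ : Finset {q : Fin 4 × Fin 4 // q.1 < q.2}))
      (w := fun _ => (1 / 6 : ℝ)) (p := fun o => 6 * a * β * E o U) (fun _ _ => by norm_num)
      (by rw [Finset.sum_const, Finset.card_univ, card_orient]; norm_num) (fun _ _ => Set.mem_univ _))
    rw [hsplit]
    simpa only [smul_eq_mul] using hj
  have hint : ∀ o : {q : Fin 4 × Fin 4 // q.1 < q.2},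
      Integrable (fun U => (1 / 6 : ℝ) * Real.exp (6 * a * β * E o U)) μ := by
    intro o
    refine (integrable_exp_of_abs_le r.ρ r.continuous β
      (measurable_mul_sum_plaqEnergy r.ρ r.continuous (6 * a * β) o (Finset.univ.filter fun x => (x, o) ∈ X))
      (B := |6 * a * β| * (2 * r.N * (Finset.univ.filter fun x => (x, o) ∈ X).card)) fun U => ?_).const_mul _
    rw [abs_mul]
    exact mul_le_mul_of_nonneg_left (abs_sum_plaqEnergy_le r.ρ r.continuous o _ U) (abs_nonneg _)
  have hLint : Integrable (fun U => Real.exp (a * β * ∑ p ∈ X, ((r.N : ℝ) - WilsonRP.plaqRe r.ρ U p))) μ := by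
    refine integrable_exp_of_abs_le r.ρ r.continuous β
      ((Finset.measurable_sum X fun p _ =>
        measurable_const.sub (WilsonRP.measurable_plaqRe r.ρ r.continuous p)).const_mul (a * β))
      (B := |a * β| * (2 * r.N * X.card)) fun U => ?_
    rw [abs_mul]
    refine mul_le_mul_of_nonneg_left ?_ (abs_nonneg _)
    rw [abs_of_nonneg (Finset.sum_nonneg fun p _ => plaqEnergy_nonneg r.ρ r.continuous U p)]
    calc ∑ p ∈ X, ((r.N : ℝ) - WilsonRP.plaqRe r.ρ U p) ≤ ∑ _p ∈ X, (2 * (r.N : ℝ)) :=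
          Finset.sum_le_sum fun p _ => plaqEnergy_le r.ρ r.continuous U p
      _ = 2 * r.N * X.card := by rw [Finset.sum_const, nsmul_eq_mul]; ring
  have h6a : 6 * a ≤ 1 / 2 := by linarith
  have h6a0 : 0 ≤ 6 * a := by linarith
  calc ∫ U, Real.exp (a * β * ∑ p ∈ X, ((r.N : ℝ) - WilsonRP.plaqRe r.ρ U p)) ∂μ
      ≤ ∫ U, ∑ o : {q : Fin 4 × Fin 4 // q.1 < q.2}, (1 / 6 : ℝ) * Real.exp (6 * a * β * E o U) ∂μ :=
        integral_mono hLint (integrable_finsetSum _ fun o _ => hint o) hJ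
    _ = ∑ o : {q : Fin 4 × Fin 4 // q.1 < q.2}, (1 / 6 : ℝ) * ∫ U, Real.exp (6 * a * β * E o U) ∂μ := by
        rw [integral_finsetSum _ fun o _ => hint o]
        refine Finset.sum_congr rfl fun o _ => ?_
        rw [integral_const_mul]
    _ ≤ ∑ _o : {q : Fin 4 × Fin 4 // q.1 < q.2}, (1 / 6 : ℝ) * Real.exp (6 * C * a * X.card) := by
        refine Finset.sum_le_sum fun o _ => mul_le_mul_of_nonneg_left ?_ (by norm_num)
        have h := hC L hL β hβ (6 * a) h6a0 h6a o (Finset.univ.filter fun x => (x, o) ∈ X)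
        have h' : ∫ U, Real.exp (6 * a * β * E o U) ∂μ ≤
            Real.exp (C * (6 * a) * (Finset.univ.filter fun x => (x, o) ∈ X).card) := by
          simpa only [hE] using h
        refine h'.trans (Real.exp_le_exp.2 ?_)
        have hc : ((Finset.univ.filter fun x => (x, o) ∈ X).card : ℝ) ≤ X.card := by
          exact_mod_cast card_classSites_le X o
        calc C * (6 * a) * ((Finset.univ.filter fun x => (x, o) ∈ X).card : ℝ) ≤ C * (6 * a) * X.card :=
              mul_le_mul_of_nonneg_left hc (by positivity)
          _ = 6 * C * a * X.card := by ring
    _ = Real.exp (6 * C * a * X.card) := by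
        rw [Finset.sum_const, Finset.card_univ, card_orient, nsmul_eq_mul]
        ring

/-- **THE MEAN PLAQUETTE ENERGY IS `O(1∕β)` ON EVEN FOUR-TORI, UNIFORMLY IN THE VOLUME**: there is `C' ≥ 0` with
`∫ (N − Re tr r(U_p)) dμ_β ≤ C'∕β` for every even torus `(ℤ∕L)⁴`, every `β ≥ 4` and every plaquette `p` (from `localExpMoment_class_even` at
`a = ½`, `Q = {x}`, and `1 + y ≤ e^y`; the even twin of `LocalPlaquetteExpMomentsAll.integral_plaqEnergy_le_div`). [folklore] -/
theorem integral_plaqEnergy_le_div_even (r : LatticeRep G) :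
    ∃ C' : ℝ, 0 ≤ C' ∧ ∀ (L : ℕ) [NeZero L], Even L → ∀ (β : ℝ), 4 ≤ β → ∀ (p : Plaquette 4 L),
      ∫ U, ((r.N : ℝ) - WilsonRP.plaqRe r.ρ U p) ∂(wilsonMeasure r.ρ β : Measure (GaugeConfig 4 L G)) ≤ C' / β := by
  obtain ⟨C, hC0, hC⟩ := localExpMoment_class_even r
  refine ⟨2 * (Real.exp (C / 2) - 1), by nlinarith [Real.add_one_le_exp (C / 2)], fun L _ hL β hβ p => ?_⟩
  haveI hprob := isProbabilityMeasure_wilsonMeasure (d := 4) (L := L) (G := G) r.ρ r.continuous β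
  set μ : Measure (GaugeConfig 4 L G) := wilsonMeasure r.ρ β with hμ
  have hβpos : 0 < β := by linarith
  obtain ⟨x, o⟩ := p
  have h := hC L hL β hβ (1 / 2) (by norm_num) le_rfl o {x}
  simp only [Finset.sum_singleton, Finset.card_singleton, Nat.cast_one, mul_one] at h
  have hAint : Integrable (fun U => (r.N : ℝ) - WilsonRP.plaqRe r.ρ U (x, o)) μ := by
    refine Integrable.of_bound
      (measurable_const.sub (WilsonRP.measurable_plaqRe r.ρ r.continuous (x, o))).aestronglyMeasurable
      (2 * r.N) (ae_of_all _ fun U => ?_)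
    rw [Real.norm_eq_abs, abs_of_nonneg (plaqEnergy_nonneg r.ρ r.continuous U (x, o))]
    exact plaqEnergy_le r.ρ r.continuous U (x, o)
  have hEint : Integrable (fun U => Real.exp (1 / 2 * β * ((r.N : ℝ) - WilsonRP.plaqRe r.ρ U (x, o)))) μ := by
    refine integrable_exp_of_abs_le r.ρ r.continuous β
      ((measurable_const.sub (WilsonRP.measurable_plaqRe r.ρ r.continuous (x, o))).const_mul _)
      (B := |1 / 2 * β| * (2 * r.N)) fun U => ?_
    rw [abs_mul, abs_of_nonneg (plaqEnergy_nonneg r.ρ r.continuous U (x, o))]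
    exact mul_le_mul_of_nonneg_left (plaqEnergy_le r.ρ r.continuous U (x, o)) (abs_nonneg _)
  have hf : Integrable (fun U => (1 : ℝ) + 1 / 2 * β * ((r.N : ℝ) - WilsonRP.plaqRe r.ρ U (x, o))) μ :=
    (integrable_const _).add (hAint.const_mul _)
  have hle : ∫ U, (1 + 1 / 2 * β * ((r.N : ℝ) - WilsonRP.plaqRe r.ρ U (x, o))) ∂μ ≤ Real.exp (C * (1 / 2)) :=
    (integral_mono hf hEint fun U => by
      dsimp only
      have := Real.add_one_le_exp (1 / 2 * β * ((r.N : ℝ) - WilsonRP.plaqRe r.ρ U (x, o)))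
      linarith).trans h
  have hsplit : ∫ U, (1 + 1 / 2 * β * ((r.N : ℝ) - WilsonRP.plaqRe r.ρ U (x, o))) ∂μ =
      1 + 1 / 2 * β * ∫ U, ((r.N : ℝ) - WilsonRP.plaqRe r.ρ U (x, o)) ∂μ := by
    rw [integral_add (integrable_const _) (hAint.const_mul _), integral_const, probReal_univ, one_smul,
      integral_const_mul]
  rw [hsplit] at hle
  rw [le_div_iff₀ hβpos]
  have : C * (1 / 2) = C / 2 := by ring
  rw [this] at hle
  nlinarith

end EvenAll

end Summit.QuantumFields.YangMills.BalabanUVNodes.N20LCSEvenAllClasses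

end
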